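import Mathlib
import Literature.MathematicalPhysics.QuantumFieldTheory.Balaban1983to89.B11GlobalMin

/-!
# `Balaban1983to89.B11HessianL2` — kernel skeleton of the SUPPLIED lemma (ML) behind the global-minimum reading of
[Balaban1985Variational] Theorem 1 (cell GAPS G-B11-E5g → C-B11-E5g-ML)

CITATION HEADER (lean-in-tree rule 2026-08-18).  Source under reproduction: T. Bałaban, *The variational problem and
background fields in renormalization group method for lattice gauge theories*, Commun. Math. Phys. **102** (1985)
277–309, doi:10.1007/bf01229381 (cell paper B11, held `paper:balaban1985-cmp102-variational-background`), with its
references [4] = [Balaban1985Averaging] (CMP 98, averaging operations: (123), (143), (147)–(149), (152)–(153),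
Props 3–5), [5] = [Balaban1985BackgroundPropagators] (CMP 99: (3.10), (3.46), Thm 3.3, Thm 3.11, (3.119)–(3.126),
(3.132)–(3.133), Thm 3.12) and [3] = [Balaban1984PropagatorsII] (CMP 96, Lemma 2.1 (2.60)–(2.61)).
WHAT THIS MODULE IS.  The tree module `…B11GlobalMin` (v1.1) isolates ONE lemma printed nowhere in the paper or its
references — convexity of the functional 𝔉 of (74) on the convex chart K = {(75), (76), (77)} (`ChartConvex K 𝔉`) —
under which Theorem 1's minimiser is GLOBAL over the space (6) ⊇ (8) (`globalMin_of_chart`, `globalMin_on_space8`);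
the paper prints the LOCAL statement only (p. 299, (142)).  The cell record `HOME/b2b-balaban-b11-g5/ML-SUPPLIED.md`
SUPPLIES that lemma: for ε₁, ε₃ below a (d, L, N)-threshold, d²/dt²|₀ 𝔉(A′ + tW) ≥ ½c_* N(W)² > 0 for every A′ ∈ K
and every tangent direction W ∈ T = {QW = 0, RD*W = 0}, N(W)² = ‖D_{U₀}W‖² + Σ_j (L^jη)^{−2}‖W‖²_{Ω_j∖Ω_{j+1}},
c_* = ¼ min{1, (L B₀ c₁(½))^{−1}}, from VERBATIM printed leaves of B11/[3]/[4]/[5] (listed there with pages) by four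
elementary steps: (A) the exact second variation of 𝔉 = 𝒜∘Φ with the cross term killed by the printed identity
(137) = [5] (3.122)–(3.126); (B) a WEIGHTED L²-coercivity of ⟨W, ΔW⟩ on T — block Schur test on the (3.46)-blocks of
𝒲^{1/2}G𝒲^{1/2} plus monotone inversion (in Cauchy–Schwarz form), and (3.10) + (38) for the derivative part;
(C) an ℓ²-Hessian bound for the k-fold averaging nonlinearity C_k of [4], uniform in k, from the printed recursion
(152) — quadratic part by UNROLLING the linear recursion (geometric series, ratio L^{−1}), higher part by an affine
recursion with contraction κ ≤ ¾; (D) four error terms controlled by one quantity.  THIS FILE kernel-checks the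
LOGICAL / ARITHMETICAL SHAPE of those steps (Mathlib-only lemmas, 0 sorry, no analytic content asserted):
`convexOn_of_segments` + `segment_convexOn_of_deriv2_nonneg` ⇒ `chartConvex_of_second_variation` (§7 of the record:
positive second variation along every segment of K ⇒ `B11GlobalMin.ChartConvex K 𝔉`); `schur_amgm`,
`schur_quadratic` (step B3); `cs_of_psd`, `gap_transfer` (step B4 without operator calculus);
`weighted_coercivity_bookkeeping` (step B6); `affine_recursion_bound` (step C4), `geom_unrolling` (step C3);
`hessian_lower_of_budget`, `hessian_pos` (§7).  The analytic leaves (kernel bounds of [5], Cauchy estimates for the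
analytic averaging functions of [4]) stay prose with page references in the record; their audit status is the one
recorded in the cell's GAPS.md (R1–R7 of the record) and is NOT changed by this module.
Value = kernel skeleton of a supplied derivation closing a located gap of a published proof, NOT summit progress.

v1.1 (2026-08-18, unit `b2b-balaban-b11-g6`, DOCFIX folding the record-only locator remarks of the boundary XREAD of v1 =
p180426, cell GAPS C-ref1-33 / REFEREE.md R80.1): (74)–(76) are printed on p. 289 [PDF 13] and (77) on p. 290 [PDF 14] of
[Balaban1985Variational] (v1 wrote «(74)–(77) p.290»); (3.10) of [Balaban1985BackgroundPropagators] is on p. 392 [PDF 4]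
(v1 wrote p. 391).  The remaining remarks (R3 «ε₃ = 4ε₂» = (114) p. 294, with ε₃ ≧ 4ε₂ printed on p. 297; R4 (3.119)
p. 419, (3.122)–(3.126) p. 420; R5 «likewise Im» an inference, not (38)) concern the record ML-SUPPLIED.md and are
entered there.  Every declaration is byte-identical to v1.
-/

namespace Literature.MathematicalPhysics.QuantumFieldTheory.Balaban1983to89.B11HessianL2

open Set

/-! ## §7 of the record: convexity on the chart from positive second variation along segments -/

section Convexity

variable {E : Type*} [AddCommGroup E] [Module ℝ E]

/-- Segment criterion: a function on a convex set `K` of a real vector space is convex on `K` as soon as its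
restriction to every segment `t ↦ 𝔉 (x + t • (y - x))`, `x, y ∈ K`, is convex on `[0, 1]`. [folklore] -/
theorem convexOn_of_segments {K : Set E} {𝔉 : E → ℝ} (hK : Convex ℝ K)
    (hseg : ∀ x ∈ K, ∀ y ∈ K, ConvexOn ℝ (Icc (0:ℝ) 1) (fun t : ℝ => 𝔉 (x + t • (y - x)))) :
    ConvexOn ℝ K 𝔉 := by
  refine ⟨hK, ?_⟩
  intro x hx y hy a b ha hb hab
  have h0 : (0:ℝ) ∈ Icc (0:ℝ) 1 := by simp
  have h1 : (1:ℝ) ∈ Icc (0:ℝ) 1 := by simp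
  have hφ := (hseg x hx y hy).2 h0 h1 ha hb hab
  have hx0 : x + (0:ℝ) • (y - x) = x := by simp
  have hy1 : x + (1:ℝ) • (y - x) = y := by simp
  have hφ' : 𝔉 (x + b • (y - x)) ≤ a * 𝔉 x + b * 𝔉 y := by simpa [hx0, hy1] using hφ
  have hpt : x + b • (y - x) = a • x + b • y := by
    have hb' : a = 1 - b := by linarith
    rw [hb']
    simp only [sub_smul, one_smul, smul_sub]
    abel
  rw [← hpt]
  simpa using hφ'

/-- The one-variable bridge (Mathlib `convexOn_of_deriv2_nonneg` on `[0,1]`): a function continuous on `[0,1]`,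
twice differentiable on `(0,1)` with non-negative second derivative there, is convex on `[0,1]`. [folklore] -/
theorem segment_convexOn_of_deriv2_nonneg (φ : ℝ → ℝ) (hc : ContinuousOn φ (Icc (0:ℝ) 1))
    (hd : DifferentiableOn ℝ φ (Ioo (0:ℝ) 1)) (hd2 : DifferentiableOn ℝ (deriv φ) (Ioo (0:ℝ) 1))
    (hnn : ∀ t ∈ Ioo (0:ℝ) 1, 0 ≤ deriv^[2] φ t) : ConvexOn ℝ (Icc (0:ℝ) 1) φ := by
  have hi : interior (Icc (0:ℝ) 1) = Ioo 0 1 := interior_Icc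
  refine convexOn_of_deriv2_nonneg (convex_Icc 0 1) hc ?_ ?_ ?_
  · rw [hi]; exact hd
  · rw [hi]; exact hd2
  · rw [hi]; exact hnn

/-- **The logical form of the supplied lemma's conclusion.**  If along every segment of the convex chart `K` the
functional is C² on `[0,1]` (in the sense of the three regularity hypotheses) with NON-NEGATIVE second derivative on
`(0,1)` — which is what ML-SUPPLIED.md §§3–7 establishes with the explicit bound d²/dt² 𝔉 ≥ ½c_* N(W)² > 0,
W = y − x ∈ T — then `𝔉` is convex on `K`, i.e. the hypothesis `ChartConvex K 𝔉` of
`B11GlobalMin.globalMin_of_chart` / `globalMin_on_space8` holds. [folklore]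
[cite: Balaban1985Variational, (74)–(76) p.289, (77) p.290, Prop. 4 p.292 (analyticity of 𝔉)] -/
theorem chartConvex_of_second_variation {K : Set E} {𝔉 : E → ℝ} (hK : Convex ℝ K)
    (hC2 : ∀ x ∈ K, ∀ y ∈ K,
      ContinuousOn (fun t : ℝ => 𝔉 (x + t • (y - x))) (Icc (0:ℝ) 1) ∧
      DifferentiableOn ℝ (fun t : ℝ => 𝔉 (x + t • (y - x))) (Ioo (0:ℝ) 1) ∧
      DifferentiableOn ℝ (deriv (fun t : ℝ => 𝔉 (x + t • (y - x)))) (Ioo (0:ℝ) 1))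
    (hpos : ∀ x ∈ K, ∀ y ∈ K, ∀ t ∈ Ioo (0:ℝ) 1, 0 ≤ deriv^[2] (fun s : ℝ => 𝔉 (x + s • (y - x))) t) :
    B11GlobalMin.ChartConvex K 𝔉 := by
  unfold B11GlobalMin.ChartConvex
  refine convexOn_of_segments hK ?_
  intro x hx y hy
  obtain ⟨hc, hd, hd2⟩ := hC2 x hx y hy
  exact segment_convexOn_of_deriv2_nonneg _ hc hd hd2 (hpos x hx y hy)

end Convexity

/-! ## Step B3 of the record: the block Schur test in AM–GM form -/

section Schur

variable {ι : Type*} [Fintype ι]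

/-- Schur test, AM–GM form: a non-negative kernel with row sums and column sums `≤ M` satisfies
`Σ_{i,j} k i j · uᵢ vⱼ ≤ (M/2)(Σ uᵢ² + Σ vⱼ²)`.  Applied in the record with `uᵢ = vᵢ = ‖P_y u‖` and
`k y y' = ‖P_y 𝒲^{1/2} G 𝒲^{1/2} P_{y'}‖ ≤ L B₀ e^{−(1/2)δ₀ d(y,y')}` (from [5] (3.46) via Thm 3.12), row sums `≤ L B₀ c₁(½)`
by [3] Lemma 2.1 (2.61). [folklore] -/
theorem schur_amgm (k : ι → ι → ℝ) (hk : ∀ i j, 0 ≤ k i j) (M : ℝ)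
    (hrow : ∀ i, ∑ j, k i j ≤ M) (hcol : ∀ j, ∑ i, k i j ≤ M) (u v : ι → ℝ) :
    ∑ i, ∑ j, k i j * (u i * v j) ≤ M / 2 * (∑ i, u i ^ 2 + ∑ j, v j ^ 2) := by
  have h1 : ∀ i j, k i j * (u i * v j) ≤ k i j * ((u i ^ 2 + v j ^ 2) / 2) := by
    intro i j
    apply mul_le_mul_of_nonneg_left _ (hk i j)
    nlinarith [sq_nonneg (u i - v j)]
  have hsplit : ∑ i, ∑ j, k i j * ((u i ^ 2 + v j ^ 2) / 2)
      = (∑ i, (u i ^ 2 / 2) * ∑ j, k i j) + ∑ j, (v j ^ 2 / 2) * ∑ i, k i j := by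
    have hterm : ∀ i j, k i j * ((u i ^ 2 + v j ^ 2) / 2) = (u i ^ 2 / 2) * k i j + (v j ^ 2 / 2) * k i j := by
      intro i j; ring
    simp only [hterm, Finset.sum_add_distrib, Finset.mul_sum]
    congr 1
    exact Finset.sum_comm
  have hu : ∑ i, (u i ^ 2 / 2) * ∑ j, k i j ≤ ∑ i, (u i ^ 2 / 2) * M := by
    apply Finset.sum_le_sum
    intro i _
    exact mul_le_mul_of_nonneg_left (hrow i) (by positivity)
  have hv : ∑ j, (v j ^ 2 / 2) * ∑ i, k i j ≤ ∑ j, (v j ^ 2 / 2) * M := by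
    apply Finset.sum_le_sum
    intro j _
    exact mul_le_mul_of_nonneg_left (hcol j) (by positivity)
  calc ∑ i, ∑ j, k i j * (u i * v j)
      ≤ ∑ i, ∑ j, k i j * ((u i ^ 2 + v j ^ 2) / 2) := by
        apply Finset.sum_le_sum; intro i _
        apply Finset.sum_le_sum; intro j _
        exact h1 i j
    _ = (∑ i, (u i ^ 2 / 2) * ∑ j, k i j) + ∑ j, (v j ^ 2 / 2) * ∑ i, k i j := hsplit
    _ ≤ (∑ i, (u i ^ 2 / 2) * M) + ∑ j, (v j ^ 2 / 2) * M := add_le_add hu hv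
    _ = M / 2 * (∑ i, u i ^ 2 + ∑ j, v j ^ 2) := by
        rw [← Finset.sum_mul, ← Finset.sum_mul, ← Finset.sum_div, ← Finset.sum_div]
        ring

/-- The quadratic-form case `u = v` of the Schur test: `Σ_{i,j} k i j uᵢ uⱼ ≤ M Σ uᵢ²` — the bound
`‖𝒲^{1/2} G 𝒲^{1/2}‖ ≤ L B₀ c₁(½) =: M_G` of step (B3). [folklore] -/
theorem schur_quadratic (k : ι → ι → ℝ) (hk : ∀ i j, 0 ≤ k i j) (M : ℝ)
    (hrow : ∀ i, ∑ j, k i j ≤ M) (hcol : ∀ j, ∑ i, k i j ≤ M) (u : ι → ℝ) :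
    ∑ i, ∑ j, k i j * (u i * u j) ≤ M * ∑ i, u i ^ 2 := by
  have h := schur_amgm k hk M hrow hcol u u
  linarith

end Schur

/-! ## Step B4 of the record: monotone inversion in Cauchy–Schwarz form -/

section MonotoneInversion

variable {E : Type*} [AddCommGroup E] [Module ℝ E]

/-- Cauchy–Schwarz for a symmetric positive-semidefinite bilinear form `g` (in the record: `g x z = ⟨x, G z⟩` with
G = (Δ_π + DRD* + Q*aQ)^{−1} of [5] (3.122), positive by Thm 3.11/3.12): `(g x z)² ≤ g x x · g z z`. [folklore] -/
theorem cs_of_psd (g : E →ₗ[ℝ] E →ₗ[ℝ] ℝ) (hsymm : ∀ x y, g x y = g y x) (hpsd : ∀ x, 0 ≤ g x x)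
    (x z : E) : (g x z) ^ 2 ≤ g x x * g z z := by
  have key : ∀ t : ℝ, 0 ≤ g z z * (t * t) + (-(2 * g x z)) * t + g x x := by
    intro t
    have h := hpsd (x - t • z)
    have hexp : g (x - t • z) (x - t • z) = g x x - 2 * t * g x z + t * t * g z z := by
      simp only [map_sub, map_smul, LinearMap.sub_apply, LinearMap.smul_apply, smul_eq_mul, hsymm z x]
      ring
    rw [hexp] at h
    linarith
  have hd := discrim_le_zero key
  unfold discrim at hd
  nlinarith [hd]

/-- Gap transfer (step B4 as pure arithmetic).  With `a = ⟨W, 𝒲W⟩ ≥ 0`, `b = ⟨W, G⁻¹W⟩ ≥ 0`,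
`c = ⟨𝒲W, G 𝒲W⟩` (so `a ≥ 0` automatically): Cauchy–Schwarz in the G-form (`cs_of_psd` with `x = 𝒲W`, `z = G⁻¹W`) gives `a² ≤ c·b`, the Schur
bound (B3) gives `c ≤ M·a`; hence `a ≤ M·b`, i.e. `⟨W, G⁻¹W⟩ ≥ M⁻¹⟨W, 𝒲W⟩` — used with `⟨W, ΔW⟩ = ⟨W, G⁻¹W⟩` on T
([5] (3.119), (3.122)). [folklore] -/
theorem gap_transfer {a b c M : ℝ} (hb : 0 ≤ b) (hM : 0 < M)
    (hcs : a ^ 2 ≤ c * b) (hschur : c ≤ M * a) : a ≤ M * b := by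
  have h1 : c * b ≤ M * a * b := mul_le_mul_of_nonneg_right hschur hb
  have h2 : a ^ 2 ≤ M * a * b := le_trans hcs h1
  rcases le_or_gt a (M * b) with h | hlt
  · exact h
  · exfalso
    have ha' : 0 < a := lt_of_le_of_lt (by positivity) hlt
    have h3 : a * a ≤ a * (M * b) := by nlinarith [h2]
    have h4 := le_of_mul_le_mul_left h3 ha'
    linarith

/-- Step B6 bookkeeping: averaging the two lower bounds `Δ ≥ M⁻¹ w` (B4) and `Δ ≥ (1 − e) D − c·e·w` (B5, from
[5] (3.10) and B11 (38)/(14) with `e = C₁B₃ε₁`, `c = 6(d−1)L²`) gives `Δ ≥ ¼ D + ¼ M⁻¹ w` once `e ≤ ½` and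
`c·e ≤ ½ M⁻¹`; i.e. `⟨W, ΔW⟩ ≥ c_* N(W)²` with `c_* = ¼ min{1, M⁻¹}`. [cite: Balaban1985BackgroundPropagators, (3.10) p.392]
[cite: Balaban1985Variational, (38) p.284] -/
theorem weighted_coercivity_bookkeeping {Δ D w M e c : ℝ} (hM : 0 < M) (hD : 0 ≤ D) (hw : 0 ≤ w)
    (h1 : M⁻¹ * w ≤ Δ) (h2 : (1 - e) * D - c * e * w ≤ Δ) (he : e ≤ 1 / 2) (hce : c * e ≤ M⁻¹ / 2) :
    (1 / 4) * D + (1 / 4) * (M⁻¹ * w) ≤ Δ := by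
  have hMi : 0 < M⁻¹ := inv_pos.mpr hM
  have h3 : (1 / 2) * D ≤ (1 - e) * D := by nlinarith
  have h4 : c * e * w ≤ M⁻¹ / 2 * w := by nlinarith
  nlinarith

end MonotoneInversion

/-! ## Step C of the record: the two recursion devices behind Lemma H (ℓ²-Hessian of C_k, uniform in k) -/

section Recursion

/-- Step C4: an affine recursion with contraction `κ < 1`, `u (m+1) ≤ κ u m + K'`, is bounded uniformly in `m` by
`max (u 0) (K'/(1 − κ))` — the k-INDEPENDENCE of μ′_* (higher-order part of Hess C_m; in the record
`κ = (2 + 2dC′₁L²α₀)L^{−2} + 4d(1+β)C″₁āL^{−4} ≤ ¾` from [4] (125), (139)–(140), (148), (152)).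
[cite: Balaban1985Averaging, (152)–(155) p.41–42] -/
theorem affine_recursion_bound (u : ℕ → ℝ) {κ K' : ℝ} (hκ0 : 0 ≤ κ) (hκ1 : κ < 1)
    (hrec : ∀ m, u (m + 1) ≤ κ * u m + K') : ∀ m, u m ≤ max (u 0) (K' / (1 - κ)) := by
  intro m
  induction m with
  | zero => exact le_max_left _ _
  | succ m ih =>
    have h1 : 0 < 1 - κ := by linarith
    have hB : K' / (1 - κ) ≤ max (u 0) (K' / (1 - κ)) := le_max_right _ _
    have hKB : K' ≤ max (u 0) (K' / (1 - κ)) * (1 - κ) := by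
      rwa [div_le_iff₀ h1] at hB
    calc u (m + 1) ≤ κ * u m + K' := hrec m
      _ ≤ κ * max (u 0) (K' / (1 - κ)) + K' := by nlinarith [ih]
      _ ≤ max (u 0) (K' / (1 - κ)) := by nlinarith [hKB]

/-- Step C3: the geometric series behind the UNROLLED linear recursion for the quadratic part C_k^{(2)}
(level-i suppression `L^{−(k−i)}` explicit in [4] (152)): `Σ_{i<k} r^i ≤ (1 − r)⁻¹` for `0 ≤ r < 1`
(used with `r = L⁻¹ ≤ ½`, giving λ_* = 4d(1+β)³C_Q L^d for every L ≥ 2). [cite: Balaban1985Averaging, (152) p.41] -/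
theorem geom_unrolling {r : ℝ} (hr0 : 0 ≤ r) (hr1 : r < 1) (k : ℕ) :
    ∑ i ∈ Finset.range k, r ^ i ≤ (1 - r)⁻¹ := by
  have h1 : 0 < 1 - r := by linarith
  have hmul : (∑ i ∈ Finset.range k, r ^ i) * (r - 1) = r ^ k - 1 := geom_sum_mul r k
  have hk : 0 ≤ r ^ k := pow_nonneg hr0 k
  have hS : (∑ i ∈ Finset.range k, r ^ i) * (1 - r) ≤ 1 := by nlinarith [hmul, hk]
  rw [inv_eq_one_div, le_div_iff₀ h1]
  exact hS

end Recursion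

/-! ## §7 of the record: the final budget -/

section Budget

/-- If the coercive part gives `c_* n` (step B) and the error terms cost at most `Θ n` with `Θ ≤ c_*/2` (steps C–D
under the smallness clause S-B11.12), the second variation `H ≥ c_* n − Θ n` is `≥ (c_*/2) n`. [folklore] -/
theorem hessian_lower_of_budget {cstar Θ n H : ℝ} (hΘ : Θ ≤ cstar / 2) (hn : 0 ≤ n)
    (hH : cstar * n - Θ * n ≤ H) : cstar / 2 * n ≤ H := by nlinarith

/-- … and it is strictly positive in every non-zero tangent direction (`n = N(W)² > 0` for `W ≠ 0` since
`⟨W, 𝒲W⟩ ≥ ‖W‖²`). [folklore] -/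
theorem hessian_pos {cstar n H : ℝ} (hc : 0 < cstar) (hn : 0 < n) (hH : cstar / 2 * n ≤ H) : 0 < H := by
  have : 0 < cstar / 2 * n := by positivity
  linarith

end Budget

end Literature.MathematicalPhysics.QuantumFieldTheory.Balaban1983to89.B11HessianL2
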